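import Mathlib
import Literature.RepresentationTheory.FiniteGroups.InducedClassFunction
import Literature.RepresentationTheory.FiniteGroups.BrauerInduction
import Summits.MatrixMultiplication.MatrixMultiplication.Theorems.LieRankDesigns.Negative.Basics
import Summits.MatrixMultiplication.MatrixMultiplication.Theorems.LevelGradedCohnUmansLieRankDesignsStubLevelOfFixedVector
import Summits.MatrixMultiplication.MatrixMultiplication.Theorems.SubgroupIdentityDesigns.Negative.BorelLevelOne
import Summits.MatrixMultiplication.MatrixMultiplication.Theorems.SubgroupIdentityDesigns.Negative.ParabolicSubgroup
import Summits.MatrixMultiplication.MatrixMultiplication.Theorems.SubgroupIdentityDesigns.Negative.ParabolicRestriction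

/-!
# Harish-Chandra induction lands in the level-`c` test space `F_c`

Supports stmt-MatrixMultiplication-14079 (route `LevelGradedCohnUmans`, crux `SubgroupIdentityDesigns`).
VALUE = theorem, NOT summit progress.

For the maximal parabolic `P^a_c ≤ GL_a(𝔽_p)` (`ParabolicSubgroup.parab`) and ANY function `σ` on the
Levi factor `GL_c(𝔽_p)`, the induced function `I^a_c σ = Ind_{P^a_c}^{GL_a} (σ ∘ ul)`
(`ParabolicRestriction.hcInd`) lies in `levelSet p a c` (Fourier transform supported on matrices of
rank `≤ c`), hence in `levelSet p a k` for every `k ≥ c` (`hcInd_mem_levelSet`).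

Proof: with the standard `a × c` frame `E = (e_1 … e_c)` one has
`[g ∈ P^a_c ∧ ul g = A] = [g E = E A]` (`mem_parab_and_ul_eq_iff`), so the zero-extension of `σ ∘ ul` is
`g ↦ Σ_{A ∈ GL_c} σ(A) [g E = E A]` and `I^a_c σ (y) = |P|⁻¹ Σ_t Σ_A σ(A) [y (tE) = t E A]`, a combination
of frame indicators `[y U₀ = W₀]`, each of level `c` (`frameIndicator_mem_levelSet`, file `BorelLevelOne`).
Also `levelSet_mono : levelSet p m c ⊆ levelSet p m k` for `c ≤ k`.
-/

set_option linter.dupNamespace false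

noncomputable section

open scoped BigOperators Matrix Classical
open Literature.RepresentationTheory.FiniteGroups
open Summit.MatrixMultiplication.MatrixMultiplication.Theorems.LieRankDesigns.Negative
  (GLm Mat fourierFn RankSupp levelSet)
open Summit.MatrixMultiplication.MatrixMultiplication.Theorems.LieRankDesigns.LevelOfFixedVector
  (smul_mem_levelSet sum_mem_levelSet)

namespace Summit.MatrixMultiplication.MatrixMultiplication.Theorems.SubgroupIdentityDesigns.Negative
namespace ParabolicLevel

open ParabolicSubgroup ParabolicRestriction

section Frame

variable {F : Type} [Field F] [Fintype F] [DecidableEq F] {a c : ℕ}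

/-- The standard `a × c` frame `E^a_c = (e_1 | … | e_c)`. -/
def frameE (F : Type) [Field F] (hc : c ≤ a) : Matrix (Fin a) (Fin c) F :=
  fun s t => if s = Fin.castLE hc t then 1 else 0

omit [Fintype F] [DecidableEq F] in
/-- `(g E)_{s t} = g_{s, t}`. -/
theorem mul_frameE_apply (hc : c ≤ a) (g : Matrix (Fin a) (Fin a) F) (s : Fin a) (t : Fin c) :
    (g * frameE F hc) s t = g s (Fin.castLE hc t) := by
  simp only [Matrix.mul_apply, frameE, mul_ite, mul_one, mul_zero, Finset.sum_ite_eq',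
    Finset.mem_univ, if_true]

omit [Fintype F] [DecidableEq F] in
/-- `(E A)_{s t} = A_{s t}` for `s < c` and `0` otherwise. -/
theorem frameE_mul_apply (hc : c ≤ a) (A : Matrix (Fin c) (Fin c) F) (s : Fin a) (t : Fin c) :
    (frameE F hc * A) s t = if h : (s : ℕ) < c then A ⟨s, h⟩ t else 0 := by
  rw [Matrix.mul_apply]
  by_cases h : (s : ℕ) < c
  · rw [dif_pos h, Finset.sum_eq_single ⟨s, h⟩]
    · rw [frameE, if_pos (show s = Fin.castLE hc ⟨s, h⟩ from Fin.ext rfl), one_mul]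
    · intro u _ hu
      rw [frameE, if_neg, zero_mul]
      intro hs
      apply hu
      ext
      simp [hs]
    · simp
  · rw [dif_neg h]
    refine Finset.sum_eq_zero fun u _ => ?_
    rw [frameE, if_neg, zero_mul]
    intro hs
    apply h
    rw [hs]
    exact u.2

/-- **Frame characterisation of the fibres of `ul`**: `g ∈ P^a_c` with `ul g = A` iff `g E = E A`. -/
theorem mem_parab_and_ul_eq_iff (hc : c ≤ a) (g : GL (Fin a) F) (A : GL (Fin c) F) :
    (∃ hg : g ∈ parab F a c, ul hc ⟨g, hg⟩ = A) ↔
      (g : Matrix (Fin a) (Fin a) F) * frameE F hc = frameE F hc * (A : Matrix (Fin c) (Fin c) F) := by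
  constructor
  · rintro ⟨hg, hA⟩
    ext s t
    rw [mul_frameE_apply, frameE_mul_apply]
    by_cases h : (s : ℕ) < c
    · rw [dif_pos h, ← hA, ul_apply, show Fin.castLE hc ⟨s, h⟩ = s from Fin.ext rfl]
    · rw [dif_neg h]
      exact mem_parab.mp hg s _ (by simp) (by omega)
  · intro h
    have hg : g ∈ parab F a c := by
      intro s t ht hs
      have := congr_fun (congr_fun h s) ⟨t, ht⟩
      rwa [mul_frameE_apply, frameE_mul_apply, dif_neg (by omega),
        show Fin.castLE hc ⟨t, ht⟩ = t from Fin.ext rfl] at this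
    refine ⟨hg, Units.ext (Matrix.ext fun s t => ?_)⟩
    have := congr_fun (congr_fun h (Fin.castLE hc s)) t
    rw [mul_frameE_apply, frameE_mul_apply, dif_pos (show ((Fin.castLE hc s : Fin a) : ℕ) < c from s.2)]
      at this
    rw [ul_apply, this]
    exact congrArg (fun i => (A : Matrix (Fin c) (Fin c) F) i t) (Fin.ext rfl)

/-- The zero-extension of `σ ∘ ul` to `GL_a` as a combination of frame indicators. -/
theorem extend_comp_ul_eq (hc : c ≤ a) (σ : GL (Fin c) F → ℂ) (x : GL (Fin a) F) :
    Function.extend (Subtype.val : parab F a c → GL (Fin a) F) (fun g => σ (ul hc g)) 0 x =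
      ∑ A : GL (Fin c) F, σ A * (if (x : Matrix (Fin a) (Fin a) F) * frameE F hc =
        frameE F hc * (A : Matrix (Fin c) (Fin c) F) then 1 else 0) := by
  by_cases hx : x ∈ parab F a c
  · rw [show x = ((⟨x, hx⟩ : parab F a c) : GL (Fin a) F) from rfl, extend_subtypeVal_apply,
      Finset.sum_eq_single (ul hc ⟨x, hx⟩)]
    · rw [if_pos ((mem_parab_and_ul_eq_iff hc x _).mp ⟨hx, rfl⟩), mul_one]
    · intro A _ hA
      rw [if_neg, mul_zero]
      intro h
      obtain ⟨hx', h'⟩ := (mem_parab_and_ul_eq_iff hc x A).mpr h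
      exact hA h'.symm
    · simp
  · rw [extend_subtypeVal_of_not_mem _ _ hx]
    refine (Finset.sum_eq_zero fun A _ => ?_).symm
    rw [if_neg, mul_zero]
    intro h
    exact hx ((mem_parab_and_ul_eq_iff hc x A).mpr h).1

/-- **`I^a_c σ` as a combination of frame indicators**:
`I^a_c σ (y) = |P|⁻¹ Σ_t Σ_A σ(A) [y (tE) = t(EA)]`. -/
theorem hcInd_eq_frameSum (hc : c ≤ a) (σ : GL (Fin c) F → ℂ) :
    hcInd hc σ = fun y : GL (Fin a) F => (Nat.card (parab F a c) : ℂ)⁻¹ *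
      ∑ t : GL (Fin a) F, ∑ A : GL (Fin c) F, σ A *
        (if (y : Matrix (Fin a) (Fin a) F) * ((t : Matrix (Fin a) (Fin a) F) * frameE F hc) =
          (t : Matrix (Fin a) (Fin a) F) * (frameE F hc * (A : Matrix (Fin c) (Fin c) F))
          then 1 else 0) := by
  funext y
  unfold hcInd indClassFun
  congr 1
  refine Finset.sum_congr rfl fun t _ => ?_
  rw [extend_comp_ul_eq]
  refine Finset.sum_congr rfl fun A _ => ?_
  congr 1
  have hiff : ((t⁻¹ * y * t : GL (Fin a) F) : Matrix (Fin a) (Fin a) F) * frameE F hc =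
      frameE F hc * (A : Matrix (Fin c) (Fin c) F) ↔
      (y : Matrix (Fin a) (Fin a) F) * ((t : Matrix (Fin a) (Fin a) F) * frameE F hc) =
        (t : Matrix (Fin a) (Fin a) F) * (frameE F hc * (A : Matrix (Fin c) (Fin c) F)) := by
    rw [Units.val_mul, Units.val_mul, Matrix.mul_assoc, Matrix.mul_assoc]
    constructor
    · intro h
      calc (y : Matrix (Fin a) (Fin a) F) * ((t : Matrix (Fin a) (Fin a) F) * frameE F hc)
          = (t : Matrix (Fin a) (Fin a) F) * (((t⁻¹ : GL (Fin a) F) : Matrix (Fin a) (Fin a) F) *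
              ((y : Matrix (Fin a) (Fin a) F) * ((t : Matrix (Fin a) (Fin a) F) * frameE F hc))) := by
            rw [← Matrix.mul_assoc (t : Matrix (Fin a) (Fin a) F), Units.mul_inv, Matrix.one_mul]
        _ = _ := by rw [h]
    · intro h
      rw [h, ← Matrix.mul_assoc (((t⁻¹ : GL (Fin a) F) : Matrix (Fin a) (Fin a) F)), Units.inv_mul,
        Matrix.one_mul]
  by_cases h : (y : Matrix (Fin a) (Fin a) F) * ((t : Matrix (Fin a) (Fin a) F) * frameE F hc) =
      (t : Matrix (Fin a) (Fin a) F) * (frameE F hc * (A : Matrix (Fin c) (Fin c) F))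
  · rw [if_pos h, if_pos (hiff.mpr h)]
  · rw [if_neg h, if_neg (fun h' => h (hiff.mp h'))]

end Frame

/-! ## Level of `I^a_c σ` over `𝔽_p` -/

variable {p : ℕ} [Fact p.Prime] {a c : ℕ}

/-- `F_c ⊆ F_k` for `c ≤ k`. -/
theorem levelSet_mono {m k : ℕ} (hck : c ≤ k) : levelSet p m c ⊆ levelSet p m k := by
  rintro f ⟨coef, hsupp, hf⟩
  exact ⟨coef, fun M hM => hsupp M (lt_of_le_of_lt hck hM), hf⟩

/-- **`I^a_c σ ∈ F_c`** for every `σ : GL_c(𝔽_p) → ℂ`. -/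
theorem hcInd_mem_levelSet_self (hc : c ≤ a) (σ : GLm p c → ℂ) : hcInd hc σ ∈ levelSet p a c := by
  rw [hcInd_eq_frameSum]
  refine smul_mem_levelSet (sum_mem_levelSet _ _ fun t _ => sum_mem_levelSet _ _ fun A _ => ?_) _
  exact smul_mem_levelSet (frameIndicator_mem_levelSet _ _) _

/-- **`I^a_c σ ∈ F_k`** for every `k ≥ c`. -/
theorem hcInd_mem_levelSet (hc : c ≤ a) (σ : GLm p c → ℂ) {k : ℕ} (hck : c ≤ k) :
    hcInd hc σ ∈ levelSet p a k :=
  levelSet_mono hck (hcInd_mem_levelSet_self hc σ)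

end ParabolicLevel
end Summit.MatrixMultiplication.MatrixMultiplication.Theorems.SubgroupIdentityDesigns.Negative
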